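import Mathlib.Algebra.Polynomial.Div
import Literature.NumberTheory.Transcendental.RoySmallValueEstimatesRecurrenceProofs
import HarnessLib

/-!
# Small value estimates at rational translates (Nguyen–Roy 2016) — proofs, IV: Lemma 7 (Mahler's formula, improved)

Fourth proofs file towards `Literature.NumberTheory.Transcendental.nguyenRoy2016_thm_1` (Nguyen–Roy,
IJNT 12 (2016) = arXiv:1412.5163). We PROVE **Lemma 7** of the paper, the authors' improvement
of Mahler's formula (7) (K. Mahler, *On a class of entire functions*, Acta Math. Acad. Sci. Hungar.
18 (1967), p. 88; also Lemma 2 of Tijdeman, J. Number Theory 5 (1973)): for the linear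
recurrence sequence

  `u_i = ∑_{ν<n} ∑_{μ<m_ν} A_{μ,ν} i^{(μ)} α_ν^{i−μ}`  (`i^{(μ)} = i(i−1)⋯(i−μ+1)`),

with `α₀, …, α_{n−1}` distinct and `M = ∑ m_ν`, every coefficient satisfies
`|A_{μ,ν}| ≤ (a₀/(a₁a₂)) max_{0 ≤ i < M} |u_i|`, where `a₀ = (max_ν C(M, m_ν)) ∏_ν (1 + |α_ν|)^{m_ν}`,
`a₁ = min_ν ∏_{ν'≠ν} |α_ν' − α_ν|^{m_ν'}`, `a₂ = min_{ν≠ν'} min{1, |α_ν' − α_ν|^{m_ν}}`.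

The proof is the paper's (following Roy 2013, Prop. 3.3): for fixed `(μ, ν)` one builds
`b = a(X − α_ν) c(X)` of degree `< M`, divisible by `(X − α_ν')^{m_ν'}` for `ν' ≠ ν` and congruent to
`(μ!)⁻¹ (X − α_ν)^μ` modulo `(X − α_ν)^{m_ν}` (`a` = Roy's truncated inverse, Lemma 3.2 of Roy 2013,
`NguyenRoy.exists_trunc_inverse`), so that `A_{μ,ν} = (b(τ)u)_0` and `|A_{μ,ν}| ≤ 𝓛(b) max_{i<M}|u_i|`.

## Main results

* `NguyenRoy.exists_interp_poly` — the polynomial `b` of the proof (degree `< M`, the divisibility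
  and congruence properties, and the length bound).
* `NguyenRoy.norm_coeff_recurrence_le` — Lemma 7 in the sharp per-coefficient form that the
  proof yields: `|A_{μ,ν}| ≤ C(M−μ−1, m_ν−μ−1) R^{m_ν−μ−1} (1+|α_ν|)^{m_ν−1}
  ∏_{ν'≠ν} ((1+|α_ν'|)/|α_ν−α_ν'|)^{m_ν'} · max_{i<M} |u_i|` for any `R ≥ 1` bounding the
  `|α_ν' − α_ν|⁻¹`, `ν' ≠ ν`.
* `NguyenRoy.norm_coeff_recurrence_le_of_bounds` — **Lemma 7 as printed**, with `a₀, a₁, a₂` entered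
  through the inequalities that define them (any `a₀ ≥ C(M, m_ν) ∏ (1+|α_ν'|)^{m_ν'}`,
  `0 < a₁ ≤ ∏_{ν'≠ν} |α_ν'−α_ν|^{m_ν'}`, `0 < a₂ ≤ min{1, |α_ν'−α_ν|^{m_ν}}` (`ν' ≠ ν`), `a₂ ≤ 1`),
  which is the form in which Proposition 8 of the paper consumes it.

## References

* [NguyenRoy2016] N. A. V. Nguyen, D. Roy, IJNT 12 (2016) = arXiv:1412.5163, §3, Lemma 7 and its
  proof.
* [Roy2013] D. Roy, Mathematika 59 (2013) = arXiv:1301.0663, Lemma 3.2 and the proof of Prop. 3.3.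
-/

noncomputable section

open Polynomial Finset

namespace Literature.NumberTheory.Transcendental

namespace NguyenRoy

/-! ### The action of `b(τ)` on the basic sequences -/

/-- If `(X − a')^{m'} ∣ b` then `b(τ)` kills `u^{(μ')}(a')` for `μ' < m'`.
[cite: NguyenRoy2016, Lemma 7 (proof)] -/
theorem aeval_shiftOp_wseq_eq_zero_of_dvd {b : ℂ[X]} {a' : ℂ} {m' μ' : ℕ}
    (hb : (X - C a') ^ m' ∣ b) (hμ' : μ' < m') : aeval shiftOp b (wseq μ' a') = 0 := by
  obtain ⟨g, rfl⟩ := hb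
  rw [mul_comm, map_mul, Module.End.mul_apply, aeval_X_sub_C_pow_wseq_of_lt hμ', map_zero]

/-- If `b = c (X − a)^μ + h (X − a)^m` then `(b(τ) u^{(μ')}(a))_0 = c μ'! δ_{μ,μ'}` for `μ' < m`.
[cite: NguyenRoy2016, Lemma 7 (proof)] -/
theorem aeval_shiftOp_wseq_apply_zero_of_eq {b h : ℂ[X]} {c a : ℂ} {μ m μ' : ℕ}
    (hb : b = C c * (X - C a) ^ μ + h * (X - C a) ^ m) (hμ' : μ' < m) :
    aeval shiftOp b (wseq μ' a) 0 = c * if μ = μ' then (μ'.factorial : ℂ) else 0 := by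
  rw [hb, map_add, map_mul, map_mul, LinearMap.add_apply, Module.End.mul_apply,
    Module.End.mul_apply, aeval_X_sub_C_pow_wseq_of_lt hμ', map_zero, add_zero, aeval_C,
    Module.algebraMap_end_apply, Pi.smul_apply, smul_eq_mul, aeval_X_sub_C_pow_wseq_zero]

/-- Translating `1 − ρX` with `ρ = (a' − a)⁻¹` to `a`: `(1 − ρX)(X − a) = (a − a')⁻¹ (X − a')`.
[cite: NguyenRoy2016, Lemma 7 (proof, the polynomials b(X) = a(X−α_ν)c(X))] -/
theorem one_sub_C_mul_X_comp_X_sub_C {a a' : ℂ} (h : a' ≠ a) :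
    ((1 : ℂ[X]) - C (a' - a)⁻¹ * X).comp (X - C a) = C (a - a')⁻¹ * (X - C a') := by
  have h1 : a' - a ≠ 0 := sub_ne_zero.mpr h
  have h2 : a - a' ≠ 0 := sub_ne_zero.mpr (Ne.symm h)
  rw [sub_comp, one_comp, mul_comp, C_comp, X_comp]
  -- compare coefficients of these two linear polynomials via `C`-arithmetic
  have key : (1 : ℂ[X]) - C (a' - a)⁻¹ * (X - C a) - C (a - a')⁻¹ * (X - C a') =
      C (1 + (a' - a)⁻¹ * a + (a - a')⁻¹ * a') + C (-(a' - a)⁻¹ - (a - a')⁻¹) * X := by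
    simp only [map_add, map_sub, map_neg, map_mul, map_one]
    ring
  have hc1 : -(a' - a)⁻¹ - (a - a')⁻¹ = 0 := by
    rw [show a - a' = -(a' - a) by ring, inv_neg]; ring
  have hc0 : 1 + (a' - a)⁻¹ * a + (a - a')⁻¹ * a' = 0 := by
    rw [show a - a' = -(a' - a) by ring, inv_neg]
    field_simp
    ring
  rw [← sub_eq_zero, key, hc0, hc1]
  simp

/-! ### The auxiliary polynomial `b = a(X − α_ν) c(X)` -/

/-- Degree of `∏ (1 − rᵢX)` is at most the number of factors. [folklore] -/
theorem natDegree_prod_one_sub_C_mul_X_le {ι : Type*} (s : Finset ι) (r : ι → ℂ) :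
    (∏ i ∈ s, ((1 : ℂ[X]) - C (r i) * X)).natDegree ≤ s.card := by
  refine (natDegree_prod_le _ _).trans ?_
  calc ∑ i ∈ s, ((1 : ℂ[X]) - C (r i) * X).natDegree ≤ ∑ _i ∈ s, 1 := by
        refine sum_le_sum fun i _ => (natDegree_sub_le _ _).trans (max_le (by simp) ?_)
        exact (natDegree_C_mul_le _ _).trans natDegree_X_le
    _ = s.card := by simp

/-- **The polynomial `b` of the proof of Lemma 7.** For distinct `α_ν'`, multiplicities `m_ν'`,
`M = ∑ m_ν'`, an index `ν` and `μ < m_ν`, and `R ≥ 1` with `|α_ν' − α_ν|⁻¹ ≤ R` (`ν' ≠ ν`), there is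
`b ∈ ℂ[X]` of degree `< M`, divisible by `(X − α_ν')^{m_ν'}` for every `ν' ≠ ν`, of the form
`(μ!)⁻¹ (X − α_ν)^μ + h (X − α_ν)^{m_ν}`, and of length
`𝓛(b) ≤ C(M−μ−1, m_ν−μ−1) R^{m_ν−μ−1} (1 + |α_ν|)^{m_ν−1} ∏_{ν'≠ν} ((1+|α_ν'|)/|α_ν−α_ν'|)^{m_ν'}`
(namely `b = a(X − α_ν) c(X)` with `c = (μ!)⁻¹ (X−α_ν)^μ ∏_{ν'≠ν} ((X−α_ν')/(α_ν−α_ν'))^{m_ν'}` and `a`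
Roy's truncated inverse). [cite: NguyenRoy2016, Lemma 7 (proof)] -/
theorem exists_interp_poly {n : ℕ} (α : Fin n → ℂ) (hα : Function.Injective α) (mult : Fin n → ℕ)
    (ν : Fin n) {μ : ℕ} (hμ : μ < mult ν) {R : ℝ} (hR : 1 ≤ R)
    (hRα : ∀ ν', ν' ≠ ν → ‖α ν' - α ν‖⁻¹ ≤ R) :
    ∃ b h : ℂ[X], b.natDegree + 1 ≤ ∑ ν', mult ν' ∧
      (∀ ν', ν' ≠ ν → (X - C (α ν')) ^ mult ν' ∣ b) ∧
      b = C ((μ.factorial : ℂ)⁻¹) * (X - C (α ν)) ^ μ + h * (X - C (α ν)) ^ mult ν ∧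
      ulen b ≤ (((∑ ν', mult ν') - μ - 1).choose (mult ν - μ - 1) : ℝ) * R ^ (mult ν - μ - 1) *
        (1 + ‖α ν‖) ^ (mult ν - 1) *
        ∏ ν' ∈ univ.erase ν, ((1 + ‖α ν'‖) / ‖α ν - α ν'‖) ^ mult ν' := by
  classical
  set M := ∑ ν', mult ν' with hM
  -- exponents `e = mult` off `ν`, `e ν = 0`
  set e : Fin n → ℕ := Function.update mult ν 0 with he
  have he_self : e ν = 0 := by simp [he]
  have he_ne : ∀ {ν' : Fin n}, ν' ≠ ν → e ν' = mult ν' := fun {ν'} h => by simp [he, h]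
  have hmultM : mult ν ≤ M := Finset.single_le_sum (fun _ _ => Nat.zero_le _) (mem_univ ν)
  have hsum_e : ∑ ν', e ν' = M - mult ν := by
    have h1 := Finset.sum_update_of_mem (mem_univ ν) mult 0
    rw [← he, Finset.sdiff_singleton_eq_erase] at h1
    have h2 := Finset.sum_erase_add univ mult (mem_univ ν)
    rw [h1]
    change 0 + ∑ x ∈ univ.erase ν, mult x = M - mult ν
    have : ∑ x ∈ univ.erase ν, mult x + mult ν = M := h2
    omega
  -- the family of inverse differences, with multiplicities
  let ι := (ν' : Fin n) × Fin (e ν')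
  let r : ι → ℂ := fun x => (α x.1 - α ν)⁻¹
  have hx1 : ∀ x : ι, x.1 ≠ ν := by
    intro x hx
    have h0 : e x.1 = 0 := by rw [hx, he_self]
    exact (x.2.cast h0).elim0
  have hr : ∀ x : ι, ‖r x‖ ≤ R := fun x => by
    change ‖(α x.1 - α ν)⁻¹‖ ≤ R
    rw [norm_inv]
    exact hRα x.1 (hx1 x)
  have hcard : Fintype.card ι = M - mult ν := by
    rw [← hsum_e]
    change Fintype.card ((ν' : Fin n) × Fin (e ν')) = _
    rw [Fintype.card_sigma]
    simp only [Fintype.card_fin]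
  -- Roy's truncated inverse
  have he₀ : 1 ≤ mult ν - μ := by omega
  obtain ⟨a, hdeg_a, hcong, hlen⟩ := exists_trunc_inverse r hR hr he₀
  set F : ℂ[X] := ∏ x : ι, (1 - C (r x) * X) with hF_def
  have hF : F = ∏ ν', ((1 : ℂ[X]) - C (α ν' - α ν)⁻¹ * X) ^ e ν' := by
    rw [hF_def]
    change ∏ x : (ν' : Fin n) × Fin (e ν'), ((1 : ℂ[X]) - C (α x.1 - α ν)⁻¹ * X) = _
    rw [Fintype.prod_sigma]
    refine prod_congr rfl fun ν' _ => ?_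
    change ∏ _y : Fin (e ν'), ((1 : ℂ[X]) - C (α ν' - α ν)⁻¹ * X) = _
    rw [prod_const, card_univ, Fintype.card_fin]
  have hdegF : F.natDegree ≤ M - mult ν := by
    rw [hF_def, ← hcard, ← card_univ]
    exact natDegree_prod_one_sub_C_mul_X_le _ _
  -- `X^{e₀} ∣ aF − 1`
  have hdvd : X ^ (mult ν - μ) ∣ a * F - 1 := by
    rw [X_pow_dvd_iff]
    intro d hd
    rw [coeff_sub, hcong d hd, coeff_one]
    by_cases h0 : d = 0
    · subst h0; simp
    · simp [h0]
  obtain ⟨q, hq⟩ := hdvd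
  -- the translated polynomials
  set g : ℂ[X] := X - C (α ν) with hg
  have hFcomp : F.comp g = ∏ ν', (C (α ν - α ν')⁻¹ * (X - C (α ν'))) ^ e ν' := by
    rw [hF, Polynomial.prod_comp]
    refine prod_congr rfl fun ν' _ => ?_
    rw [pow_comp]
    by_cases hν' : ν' = ν
    · rw [hν', he_self, pow_zero, pow_zero]
    · rw [hg, one_sub_C_mul_X_comp_X_sub_C (hα.ne hν')]
  -- definition of `b` and `h`
  set c : ℂ := (μ.factorial : ℂ)⁻¹ with hc
  refine ⟨C c * g ^ μ * (a * F).comp g, C c * q.comp g, ?_, ?_, ?_, ?_⟩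
  · -- degree
    have h1 : (C c * g ^ μ * (a * F).comp g).natDegree ≤ μ + (a.natDegree + F.natDegree) := by
      refine natDegree_mul_le.trans (add_le_add ?_ ?_)
      · refine (natDegree_C_mul_le _ _).trans ((natDegree_pow_le).trans ?_)
        rw [hg, natDegree_X_sub_C, mul_one]
      · refine natDegree_comp_le.trans ?_
        rw [hg, natDegree_X_sub_C, mul_one]
        exact natDegree_mul_le
    omega
  · -- divisibility by `(X − α_ν')^{m_ν'}`
    intro ν' hν'
    have h1 : (X - C (α ν')) ^ mult ν' ∣ F.comp g := by
      rw [hFcomp, ← he_ne hν']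
      refine dvd_trans ?_ (Finset.dvd_prod_of_mem
        (fun ν'' => (C (α ν - α ν'')⁻¹ * (X - C (α ν''))) ^ e ν'') (mem_univ ν'))
      rw [mul_pow]
      exact dvd_mul_left _ _
    rw [mul_comp]
    exact (h1.trans (dvd_mul_left _ _)).trans (dvd_mul_left _ _)
  · -- the shape `c g^μ + h g^{m_ν}`
    have haF : a * F = X ^ (mult ν - μ) * q + 1 := by rw [← hq]; ring
    rw [haF, add_comp, mul_comp, X_pow_comp, one_comp]
    have hexp : mult ν = μ + (mult ν - μ) := by omega
    conv_rhs => rw [hexp, pow_add]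
    ring
  · -- the length
    have hc1 : ‖c‖ ≤ 1 := by
      rw [hc, norm_inv, Complex.norm_natCast]
      exact inv_le_one_of_one_le₀ (by exact_mod_cast Nat.one_le_iff_ne_zero.mpr (Nat.factorial_ne_zero μ))
    have hg' : g = X + C (-α ν) := by rw [hg, C_neg, sub_eq_add_neg]
    have hα1 : 1 ≤ 1 + ‖α ν‖ := le_add_of_nonneg_right (norm_nonneg _)
    -- `𝓛(a(X − α_ν)) ≤ 𝓛(a) (1+|α_ν|)^{e₀−1}`
    have hla : ulen (a.comp g) ≤ ulen a * (1 + ‖α ν‖) ^ (mult ν - μ - 1) := by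
      rw [hg']
      refine (ulen_comp_X_add_C_le a _).trans ?_
      rw [norm_neg]
      exact mul_le_mul_of_nonneg_left (pow_le_pow_right₀ hα1 (by omega)) (ulen_nonneg _)
    -- `𝓛(F(X − α_ν)) ≤ ∏ ((1+|α_ν'|)/|α_ν−α_ν'|)^{e ν'}`
    have hlF : ulen (F.comp g) ≤ ∏ ν', ((1 + ‖α ν'‖) / ‖α ν - α ν'‖) ^ e ν' := by
      rw [hFcomp]
      refine (ulen_prod_le _ _).trans (prod_le_prod (fun _ _ => ulen_nonneg _) fun ν' _ => ?_)
      refine (ulen_pow_le _ _).trans (pow_le_pow_left₀ (ulen_nonneg _) ?_ _)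
      rw [ulen_C_mul, ulen_X_sub_C, norm_inv, div_eq_inv_mul]
    -- `𝓛(g^μ) ≤ (1+|α_ν|)^μ`
    have hlg : ulen (g ^ μ) ≤ (1 + ‖α ν‖) ^ μ := by
      refine (ulen_pow_le _ _).trans ?_
      rw [hg, ulen_X_sub_C]
    -- assemble
    have hprod : ∏ ν', ((1 + ‖α ν'‖) / ‖α ν - α ν'‖) ^ e ν' =
        ∏ ν' ∈ univ.erase ν, ((1 + ‖α ν'‖) / ‖α ν - α ν'‖) ^ mult ν' := by
      rw [← Finset.mul_prod_erase univ _ (mem_univ ν), he_self, pow_zero, one_mul]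
      exact prod_congr rfl fun ν' hν' => by rw [he_ne (ne_of_mem_erase hν')]
    have hcard' : mult ν - μ - 1 + Fintype.card ι = M - μ - 1 := by rw [hcard]; omega
    rw [hcard'] at hlen
    have hP0 : 0 ≤ ∏ ν' ∈ univ.erase ν, ((1 + ‖α ν'‖) / ‖α ν - α ν'‖) ^ mult ν' :=
      prod_nonneg fun _ _ => pow_nonneg (div_nonneg (by positivity) (norm_nonneg _)) _
    calc ulen (C c * g ^ μ * (a * F).comp g)
        = ‖c‖ * ulen (g ^ μ * (a.comp g * F.comp g)) := by rw [mul_assoc, ulen_C_mul, mul_comp]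
      _ ≤ 1 * (ulen (g ^ μ) * (ulen (a.comp g) * ulen (F.comp g))) := by
          refine mul_le_mul hc1 ?_ (ulen_nonneg _) zero_le_one
          exact (ulen_mul_le _ _).trans (mul_le_mul_of_nonneg_left (ulen_mul_le _ _) (ulen_nonneg _))
      _ ≤ (1 + ‖α ν‖) ^ μ * ((ulen a * (1 + ‖α ν‖) ^ (mult ν - μ - 1)) *
            ∏ ν' ∈ univ.erase ν, ((1 + ‖α ν'‖) / ‖α ν - α ν'‖) ^ mult ν') := by
          rw [one_mul, ← hprod]
          refine mul_le_mul hlg (mul_le_mul hla hlF (ulen_nonneg _) ?_) ?_ (by positivity)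
          · exact mul_nonneg (ulen_nonneg _) (by positivity)
          · exact mul_nonneg (ulen_nonneg _) (ulen_nonneg _)
      _ ≤ (1 + ‖α ν‖) ^ μ * (((((M - μ - 1).choose (mult ν - μ - 1) : ℕ) : ℝ) * R ^ (mult ν - μ - 1) *
            (1 + ‖α ν‖) ^ (mult ν - μ - 1)) *
            ∏ ν' ∈ univ.erase ν, ((1 + ‖α ν'‖) / ‖α ν - α ν'‖) ^ mult ν') := by
          gcongr
      _ = _ := by
          have hexp : mult ν - 1 = μ + (mult ν - μ - 1) := by omega
          rw [hexp, pow_add]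
          ring

/-! ### Lemma 7 -/

/-- **Nguyen–Roy 2016, Lemma 7 (sharp per-coefficient form).** Let `α₀, …, α_{n−1} ∈ ℂ` be distinct,
`m_ν ∈ ℕ`, `M = ∑ m_ν`, and `u = ∑_ν ∑_{μ<m_ν} A_{μ,ν} u^{(μ)}(α_ν)`, i.e.
`u_i = ∑_ν ∑_{μ<m_ν} A_{μ,ν} i^{(μ)} α_ν^{i−μ}`. If `|u_i| ≤ B` for `0 ≤ i < M`, then for every `ν`
and `μ < m_ν`, and every `R ≥ 1` with `|α_ν' − α_ν|⁻¹ ≤ R` for `ν' ≠ ν`,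
`|A_{μ,ν}| ≤ C(M−μ−1, m_ν−μ−1) R^{m_ν−μ−1} (1+|α_ν|)^{m_ν−1} ∏_{ν'≠ν} ((1+|α_ν'|)/|α_ν−α_ν'|)^{m_ν'} B`
(this is the bound `𝓛(b) max |u_i|` of the paper's proof, before it is weakened to `a₀/(a₁a₂)`).
[cite: NguyenRoy2016, Lemma 7 (proof)] -/
theorem norm_coeff_recurrence_le {n : ℕ} (α : Fin n → ℂ) (hα : Function.Injective α)
    (mult : Fin n → ℕ) (A : Fin n → ℕ → ℂ) {B : ℝ}
    (hB : ∀ i < ∑ ν, mult ν, ‖(∑ ν, ∑ μ ∈ range (mult ν), A ν μ • wseq μ (α ν)) i‖ ≤ B)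
    (ν : Fin n) {μ : ℕ} (hμ : μ < mult ν) {R : ℝ} (hR : 1 ≤ R)
    (hRα : ∀ ν', ν' ≠ ν → ‖α ν' - α ν‖⁻¹ ≤ R) :
    ‖A ν μ‖ ≤ (((∑ ν', mult ν') - μ - 1).choose (mult ν - μ - 1) : ℝ) * R ^ (mult ν - μ - 1) *
      (1 + ‖α ν‖) ^ (mult ν - 1) *
      (∏ ν' ∈ univ.erase ν, ((1 + ‖α ν'‖) / ‖α ν - α ν'‖) ^ mult ν') * B := by
  classical
  obtain ⟨b, h, hdeg, hdvd, hb, hlen⟩ := exists_interp_poly α hα mult ν hμ hR hRα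
  set u : ℕ → ℂ := ∑ ν', ∑ μ' ∈ range (mult ν'), A ν' μ' • wseq μ' (α ν') with hu
  -- `A_{μ,ν} = (b(τ) u)_0`
  have hkey : aeval shiftOp b u 0 = A ν μ := by
    rw [hu, map_sum, Finset.sum_apply, Finset.sum_eq_single ν]
    · rw [map_sum, Finset.sum_apply, Finset.sum_eq_single μ]
      · rw [map_smul, Pi.smul_apply, smul_eq_mul, aeval_shiftOp_wseq_apply_zero_of_eq hb hμ,
          if_pos rfl, inv_mul_cancel₀ (Nat.cast_ne_zero.mpr (Nat.factorial_ne_zero μ)), mul_one]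
      · intro μ' hμ' hne
        rw [map_smul, Pi.smul_apply, smul_eq_mul,
          aeval_shiftOp_wseq_apply_zero_of_eq hb (mem_range.mp hμ'), if_neg (Ne.symm hne),
          mul_zero, mul_zero]
      · intro hμn
        exact absurd (mem_range.mpr hμ) hμn
    · intro ν' _ hν'
      rw [map_sum, Finset.sum_apply]
      refine Finset.sum_eq_zero fun μ' hμ' => ?_
      rw [map_smul, Pi.smul_apply, aeval_shiftOp_wseq_eq_zero_of_dvd (hdvd ν' hν') (mem_range.mp hμ'),
        Pi.zero_apply, smul_zero]
    · intro hν
      exact absurd (mem_univ ν) hν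
  -- `|A_{μ,ν}| ≤ 𝓛(b) B`
  have hB' : ∀ k ≤ b.natDegree, ‖u k‖ ≤ B := fun k hk => hB k (by omega)
  have h1 : ‖A ν μ‖ ≤ ulen b * B := by
    rw [← hkey]
    exact norm_aeval_shiftOp_apply_zero_le b u hB'
  have hB0 : 0 ≤ B := (norm_nonneg _).trans (hB 0 (by omega))
  exact h1.trans (mul_le_mul_of_nonneg_right hlen hB0)

/-- **Nguyen–Roy 2016, Lemma 7** (improvement of Mahler's formula), as printed, with the constants
entered through their defining inequalities. Let `α₀, …, α_{n−1} ∈ ℂ` be distinct, `m_ν ≥ 1`,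
`M = ∑ m_ν`, `u_i = ∑_ν ∑_{μ<m_ν} A_{μ,ν} i^{(μ)} α_ν^{i−μ}` (`i ∈ ℕ`), and suppose
`max_{0≤i<M} |u_i| ≤ B`. Let `a₀ ≥ C(M, m_ν) ∏_ν' (1 + |α_ν'|)^{m_ν'}` (the paper:
`a₀ = (max_ν C(M, m_ν)) ∏ (1+|α_ν|)^{m_ν}`), `0 < a₁ ≤ ∏_{ν'≠ν} |α_ν' − α_ν|^{m_ν'}` (the paper: the
minimum over `ν`), and `0 < a₂ ≤ 1` with `a₂ ≤ |α_ν' − α_ν|^{m_ν}` for all `ν' ≠ ν` (the paper: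
`a₂ = min_{ν≠ν'} {1, |α_ν'−α_ν|^{m_ν}}`, `= 1` if `n = 1`). Then `|A_{μ,ν}| ≤ (a₀/(a₁a₂)) B`.
[cite: NguyenRoy2016, Lemma 7] -/
theorem norm_coeff_recurrence_le_of_bounds {n : ℕ} (α : Fin n → ℂ) (hα : Function.Injective α)
    (mult : Fin n → ℕ) (A : Fin n → ℕ → ℂ) {B : ℝ}
    (hB : ∀ i < ∑ ν, mult ν, ‖(∑ ν, ∑ μ ∈ range (mult ν), A ν μ • wseq μ (α ν)) i‖ ≤ B)
    (ν : Fin n) {μ : ℕ} (hμ : μ < mult ν) {a₀ a₁ a₂ : ℝ}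
    (ha₀ : ((∑ ν', mult ν').choose (mult ν) : ℝ) * ∏ ν', (1 + ‖α ν'‖) ^ mult ν' ≤ a₀)
    (ha₁ : 0 < a₁) (ha₁' : a₁ ≤ ∏ ν' ∈ univ.erase ν, ‖α ν' - α ν‖ ^ mult ν')
    (ha₂ : 0 < a₂) (ha₂1 : a₂ ≤ 1) (ha₂' : ∀ ν', ν' ≠ ν → a₂ ≤ ‖α ν' - α ν‖ ^ mult ν) :
    ‖A ν μ‖ ≤ a₀ / (a₁ * a₂) * B := by
  classical
  set M := ∑ ν', mult ν' with hM
  have hμM : μ + 1 ≤ M := (Nat.succ_le_of_lt hμ).trans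
    (Finset.single_le_sum (fun _ _ => Nat.zero_le _) (mem_univ ν))
  -- the radius `R = max(1, max_{ν'≠ν} |α_ν'−α_ν|⁻¹)` and `R^{m_ν−μ−1} ≤ 1/a₂`
  have ha₂inv : 1 ≤ a₂⁻¹ := one_le_inv_iff₀.mpr ⟨ha₂, ha₂1⟩
  obtain ⟨R, hR1, hRα, hRa₂⟩ : ∃ R : ℝ, 1 ≤ R ∧ (∀ ν', ν' ≠ ν → ‖α ν' - α ν‖⁻¹ ≤ R) ∧
      R ^ (mult ν - μ - 1) ≤ a₂⁻¹ := by
    by_cases hne : (univ.erase ν).Nonempty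
    · obtain ⟨ν₁, hν₁, hmax⟩ := Finset.exists_mem_eq_sup' hne (fun ν' => ‖α ν' - α ν‖⁻¹)
      refine ⟨max 1 ((univ.erase ν).sup' hne fun ν' => ‖α ν' - α ν‖⁻¹), le_max_left _ _, ?_, ?_⟩
      · intro ν' hν'
        exact (Finset.le_sup' (fun ν' => ‖α ν' - α ν‖⁻¹) (mem_erase.mpr ⟨hν', mem_univ _⟩)).trans
          (le_max_right _ _)
      · rw [hmax]
        have hν₁ne : ν₁ ≠ ν := ne_of_mem_erase hν₁
        have hx0 : 0 < ‖α ν₁ - α ν‖ := norm_pos_iff.mpr (sub_ne_zero.mpr (hα.ne hν₁ne))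
        rcases le_or_gt ‖α ν₁ - α ν‖⁻¹ 1 with hle | hgt
        · rw [max_eq_left hle, one_pow]
          exact ha₂inv
        · rw [max_eq_right hgt.le]
          calc ‖α ν₁ - α ν‖⁻¹ ^ (mult ν - μ - 1) ≤ ‖α ν₁ - α ν‖⁻¹ ^ mult ν :=
                pow_le_pow_right₀ hgt.le (by omega)
            _ = (‖α ν₁ - α ν‖ ^ mult ν)⁻¹ := by rw [inv_pow]
            _ ≤ a₂⁻¹ := inv_anti₀ ha₂ (ha₂' ν₁ hν₁ne)
    · refine ⟨1, le_rfl, fun ν' hν' => ?_, by rw [one_pow]; exact ha₂inv⟩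
      exact absurd ⟨ν', mem_erase.mpr ⟨hν', mem_univ _⟩⟩ hne
  have h := norm_coeff_recurrence_le α hα mult A hB ν hμ hR1 hRα
  -- compare the constants
  have hB0 : 0 ≤ B := (norm_nonneg _).trans (hB 0 (by omega))
  have hchoose : ((M - μ - 1).choose (mult ν - μ - 1) : ℝ) ≤ (M.choose (mult ν) : ℝ) := by
    have key : ∀ a b j : ℕ, a.choose b ≤ (a + j).choose (b + j) := by
      intro a b j
      induction j with
      | zero => simp
      | succ j ih =>
        rw [← add_assoc, ← add_assoc, Nat.choose_succ_succ]
        exact ih.trans (Nat.le_add_right _ _)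
    have := key (M - μ - 1) (mult ν - μ - 1) (μ + 1)
    rw [show M - μ - 1 + (μ + 1) = M by omega, show mult ν - μ - 1 + (μ + 1) = mult ν by omega]
      at this
    exact_mod_cast this
  have hα1 : 1 ≤ 1 + ‖α ν‖ := le_add_of_nonneg_right (norm_nonneg _)
  have hpow : (1 + ‖α ν‖) ^ (mult ν - 1) ≤ (1 + ‖α ν‖) ^ mult ν :=
    pow_le_pow_right₀ hα1 (Nat.sub_le _ _)
  set N' : ℝ := ∏ ν' ∈ univ.erase ν, (1 + ‖α ν'‖) ^ mult ν' with hN'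
  set D' : ℝ := ∏ ν' ∈ univ.erase ν, ‖α ν - α ν'‖ ^ mult ν' with hD'
  have hN'0 : 0 ≤ N' := prod_nonneg fun _ _ => by positivity
  have hD'a : a₁ ≤ D' := by
    rw [hD']
    convert ha₁' using 3 with ν' _
    rw [norm_sub_rev]
  have hprod : ∏ ν' ∈ univ.erase ν, ((1 + ‖α ν'‖) / ‖α ν - α ν'‖) ^ mult ν' = N' / D' := by
    rw [hN', hD', ← prod_div_distrib]
    exact prod_congr rfl fun ν' _ => div_pow _ _ _
  have hX₄ : N' / D' ≤ N' / a₁ := div_le_div_of_nonneg_left hN'0 ha₁ hD'a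
  have hall : (M.choose (mult ν) : ℝ) * ((1 + ‖α ν‖) ^ mult ν * N') ≤ a₀ := by
    rw [hN', Finset.mul_prod_erase univ (fun ν' => (1 + ‖α ν'‖) ^ mult ν') (mem_univ ν)]
    exact ha₀
  rw [hprod] at h
  calc ‖A ν μ‖ ≤ ((M - μ - 1).choose (mult ν - μ - 1) : ℝ) * R ^ (mult ν - μ - 1) *
        (1 + ‖α ν‖) ^ (mult ν - 1) * (N' / D') * B := h
    _ ≤ (M.choose (mult ν) : ℝ) * a₂⁻¹ * (1 + ‖α ν‖) ^ mult ν * (N' / a₁) * B := by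
        gcongr
    _ = (M.choose (mult ν) : ℝ) * ((1 + ‖α ν‖) ^ mult ν * N') / (a₁ * a₂) * B := by
        field_simp
    _ ≤ a₀ / (a₁ * a₂) * B := by
        gcongr

end NguyenRoy

end Literature.NumberTheory.Transcendental
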